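import Mathlib.Analysis.InnerProductSpace.Dual
import Mathlib.Analysis.InnerProductSpace.Projection.Basic
import Mathlib.Analysis.Calculus.Deriv.Comp
import Literature.RepresentationTheory.Unitary.InvariantSubspaceBicommutant
import HarnessLib

/-!
# Eigenvectors from covariant functionals; annihilators under generating operators

Topic `RepresentationTheory/Unitary`; namespace `Literature.RepresentationTheory.Unitary`. Two elementary
mechanisms by which "a character occurs in a unitary representation" is proved in practice, for ANY group `T`
acting by `ρ : T →* (H →L[ℂ] H)` with `IsUnitaryRep ρ` (`⟪ρ t u, ρ t v⟫ = ⟪u, v⟫`; no topology on `T`):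

* **Covariant functionals** (`exists_eigenvector_of_covariant_functional`). A continuous linear functional `l`
  with `l (ρ t v) = w t * l v` for a unitary character `w : T →* ℂ` (`‖w t‖ = 1`), non-zero somewhere on a
  `ρ`-invariant subspace `S` carrying an orthogonal-projection package `e` (lands in `S`, fixes `S`,
  self-adjoint), forces a non-zero `y ∈ S` with `ρ t y = w t • y` for all `t`: the Riesz vector `x` of `l` is a
  `w`-eigenvector by unitarity, `e` commutes with `ρ` (`proj_commute`), and `y := e x` has `⟪y, v₀⟫ = l v₀ ≠ 0`.
  This is the Hilbert-space form of the classical averaging argument `P_w = ∫_T w̄(t) ρ(t) dt` for compact `T`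
  (Folland, *A course in abstract harmonic analysis* (1995), §5.1; Mackey, *The theory of unitary group
  representations* (1976), Ch. 1), with the Haar integral replaced by the Riesz representation theorem, so that
  neither compactness of `T` nor continuity of `ρ` is needed. `exists_eigenvector_of_covariant_functional_closed`
  is the case of a closed complete `S` with `e = S.starProjection`.
* **Annihilators under generating operators** (`annihilatorIn`, `vanishes_of_generator_of_stable`,
  `pairing_vanishes_of_generator`; pure linear algebra). For a pairing `B : F →ₗ[ℂ] (V → ℂ)` the annihilator
  `{φ | ∀ v ∈ S, B φ v = 0}` of a set `S ⊆ V` is a submodule; if it is stable under operators `X k` which generate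
  `F` from one vector `φ₀` (every `X`-stable submodule containing `φ₀` is `⊤`) and contains `φ₀`, it is all of `F`.
  The stability typically comes from infinitesimal invariance `B (X k φ) v = - B φ (Y k v)` on a `Y`-stable set of
  "smooth vectors" (`pairing_vanishes_of_generator`) — the algebraic skeleton of "a `𝔤`-invariant pairing
  vanishing on a cyclic vector vanishes identically".
* `hasDerivAt_apply_eq_zero` — uniqueness of derivatives read on one vector: if a curve of functionals `L s`
  kills `v` for every `s`, so does its derivative (used to pass from orbit stability to infinitesimal stability).

Everything is proved from Mathlib (+ the tree's `IsUnitaryRep`). Mathlib has the Riesz map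
`InnerProductSpace.toDual`, `Submodule.starProjection` and `Complex.inv_eq_conj`, but no statement producing an
eigenvector from a covariant functional (`lean search 'covariant_functional|eigenvector_of_covariant'`: no hits
outside this file).

## Provenance

Reproduced for the tree under the LEAN-IN-TREE rule (2026-08-18) from the pub-hodgecm formalisation cell's
standalone package files `HodgeCM/PerL34/ArchC.lean` (DAG-node prover #06 lineage, seat pv06, gate run 21; its
Mathlib-only "Layer A" and pure-algebra "Layer B") and `HodgeCM/PerL34/ArchCOrbit.lean` (seat pv06-g6, gate
run 30; its §0 and §2), verbatim up to the namespace (`HodgeCM.PerL34.ArchC` ↦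
`Literature.RepresentationTheory.Unitary`), the hypothesis spelling `IsUnitaryRep ρ`, the docstrings, and the
added closed-subspace corollary. The model-specific layers of those files (over the cell's posited interfaces)
are NOT reproduced here.
-/

set_option autoImplicit false

open scoped InnerProductSpace
open ContinuousLinearMap

namespace Literature.RepresentationTheory.Unitary

/-! ## Orthogonal-projection packages and unitary representations -/

section Projection

variable {H : Type*} [NormedAddCommGroup H] [InnerProductSpace ℂ H]
variable {Tg : Type*} [Group Tg]

/-- An *orthogonal-projection package* for a subspace `S` — an operator `e` that lands in `S`, fixes `S` and is
self-adjoint — kills every vector orthogonal to `S`. (No closedness or completeness is assumed; for a closed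
complete `S`, `e = S.starProjection` is such a package.) [folklore] -/
theorem proj_eq_zero_of_orthogonal (S : Submodule ℂ H) (e : H →L[ℂ] H)
    (he_mem : ∀ v, e v ∈ S) (he_fix : ∀ v ∈ S, e v = v) (he_sa : ∀ u v, ⟪e u, v⟫_ℂ = ⟪u, e v⟫_ℂ)
    (u : H) (hu : ∀ s ∈ S, ⟪u, s⟫_ℂ = 0) : e u = 0 := by
  have h1 : ⟪e u, e u⟫_ℂ = 0 := by
    rw [he_sa u (e u), he_fix (e u) (he_mem u)]
    exact hu (e u) (he_mem u)
  exact inner_self_eq_zero.mp h1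

/-- For an orthogonal-projection package `e` of `S`, `v - e v` is orthogonal to `S`. [folklore] -/
theorem sub_proj_orthogonal (S : Submodule ℂ H) (e : H →L[ℂ] H)
    (he_fix : ∀ v ∈ S, e v = v) (he_sa : ∀ u v, ⟪e u, v⟫_ℂ = ⟪u, e v⟫_ℂ)
    (v : H) : ∀ s ∈ S, ⟪v - e v, s⟫_ℂ = 0 := by
  intro s hs
  rw [inner_sub_left, he_sa v s, he_fix s hs, sub_self]

/-- For a representation `ρ : Tg →* (H →L[ℂ] H)` (a monoid morphism into bounded operators),
`ρ t (ρ t⁻¹ u) = u`. [folklore] -/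
theorem rep_apply_inv (ρ : Tg →* (H →L[ℂ] H)) (t : Tg) (u : H) : ρ t (ρ t⁻¹ u) = u := by
  rw [← mul_apply_eq_comp, ← map_mul, mul_inv_cancel, map_one, one_apply_eq_self]

/-- An orthogonal-projection package `e` of a `ρ`-INVARIANT subspace `S` (not necessarily closed) commutes with
a unitary `ρ`: `e (ρ t v) = ρ t (e v)`. (For closed `S` this is the statement that the orthogonal projection
onto an invariant subspace lies in the commutant of `ρ(T)`, cf.
`Literature.RepresentationTheory.Unitary.starProjection_mem_commutant`; here it is derived for the package
from invariance and unitarity alone.) [folklore] -/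
theorem proj_commute (ρ : Tg →* (H →L[ℂ] H)) (hρ : IsUnitaryRep ρ)
    (S : Submodule ℂ H) (hS : ∀ (t : Tg), ∀ v ∈ S, ρ t v ∈ S)
    (e : H →L[ℂ] H) (he_mem : ∀ v, e v ∈ S) (he_fix : ∀ v ∈ S, e v = v)
    (he_sa : ∀ u v, ⟪e u, v⟫_ℂ = ⟪u, e v⟫_ℂ) (t : Tg) (v : H) :
    e (ρ t v) = ρ t (e v) := by
  have hsplit : ρ t v = ρ t (e v) + ρ t (v - e v) := by
    rw [← map_add, add_sub_cancel]
  have hkill : e (ρ t (v - e v)) = 0 := by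
    apply proj_eq_zero_of_orthogonal S e he_mem he_fix he_sa
    intro s hs
    rw [← rep_apply_inv ρ t s, hρ t]
    exact sub_proj_orthogonal S e he_fix he_sa v (ρ t⁻¹ s) (hS t⁻¹ s hs)
  rw [hsplit, map_add, hkill, add_zero, he_fix _ (hS t _ (he_mem v))]

end Projection

/-! ## Eigenvectors from covariant functionals -/

section Covariant

variable {H : Type*} [NormedAddCommGroup H] [InnerProductSpace ℂ H] [CompleteSpace H]
variable {Tg : Type*} [Group Tg]

/-- **Occurrence of a character from a covariant functional.** Let `ρ` be a unitary representation of a group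
`T` on a Hilbert space `H`, `w : T →* ℂ` a unitary character, `S ≤ H` a `ρ`-invariant subspace with an
orthogonal-projection package `e` (lands in `S`, fixes `S`, self-adjoint), and `l` a continuous linear functional
with the covariance `l (ρ t v) = w t * l v`. If `l v₀ ≠ 0` for some `v₀ ∈ S`, then `S` contains a non-zero
vector `y` with `ρ t y = w t • y` for all `t`. Proof: the Riesz vector `x` of `l` (`l v = ⟪x, v⟫`) satisfies
`ρ t x = w t • x` by unitarity and `w t⁻¹ = conj (w t)`; `y := e x` works since `e` commutes with `ρ`
(`proj_commute`) and `⟪y, v₀⟫ = l v₀ ≠ 0`. This is the Riesz-vector form of the averaging projection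
`∫_T w̄(t) ρ(t) dt` of the compact case (Folland 1995, §5.1); no compactness of `T` or continuity of `ρ` is
used. [folklore] -/
theorem exists_eigenvector_of_covariant_functional
    (ρ : Tg →* (H →L[ℂ] H)) (hρ : IsUnitaryRep ρ)
    (w : Tg →* ℂ) (hw : ∀ t, ‖w t‖ = 1)
    (S : Submodule ℂ H) (hS : ∀ (t : Tg), ∀ v ∈ S, ρ t v ∈ S)
    (e : H →L[ℂ] H) (he_mem : ∀ v, e v ∈ S) (he_fix : ∀ v ∈ S, e v = v)
    (he_sa : ∀ u v, ⟪e u, v⟫_ℂ = ⟪u, e v⟫_ℂ)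
    (l : H →L[ℂ] ℂ) (hl : ∀ (t : Tg) (v : H), l (ρ t v) = w t * l v)
    {v₀ : H} (hv₀ : v₀ ∈ S) (h₀ : l v₀ ≠ 0) :
    ∃ y ∈ S, y ≠ 0 ∧ ∀ t, ρ t y = w t • y := by
  -- the Riesz vector of l
  set x : H := (InnerProductSpace.toDual ℂ H).symm l with hx
  have hlx : ∀ v, l v = ⟪x, v⟫_ℂ := fun v => by
    rw [hx, InnerProductSpace.toDual_symm_apply]
  -- w is unitary: w t⁻¹ = conj (w t)
  have hwinv : ∀ t, w t⁻¹ = starRingEnd ℂ (w t) := fun t => by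
    rw [map_inv, Complex.inv_eq_conj (hw t)]
  -- x is a w-eigenvector of ρ
  have hxe : ∀ t, ρ t x = w t • x := by
    intro t
    apply ext_inner_right ℂ
    intro u
    calc ⟪ρ t x, u⟫_ℂ = ⟪ρ t x, ρ t (ρ t⁻¹ u)⟫_ℂ := by rw [rep_apply_inv]
      _ = ⟪x, ρ t⁻¹ u⟫_ℂ := hρ t x _
      _ = l (ρ t⁻¹ u) := (hlx _).symm
      _ = w t⁻¹ * l u := hl _ _
      _ = starRingEnd ℂ (w t) * ⟪x, u⟫_ℂ := by rw [hwinv, hlx]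
      _ = ⟪w t • x, u⟫_ℂ := by rw [inner_smul_left]
  refine ⟨e x, he_mem x, ?_, ?_⟩
  · -- ⟪e x, v₀⟫ = l v₀ ≠ 0
    intro hzero
    apply h₀
    rw [hlx, ← he_fix v₀ hv₀, ← he_sa, hzero, inner_zero_left]
  · intro t
    rw [← proj_commute ρ hρ S hS e he_mem he_fix he_sa t x, hxe t, map_smul]

/-- `exists_eigenvector_of_covariant_functional` for a CLOSED complete invariant subspace `S`, with the package
`e := S.starProjection` (Mathlib: `Submodule.starProjection_apply_mem`, `Submodule.starProjection_eq_self_iff`,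
`Submodule.inner_starProjection_left_eq_right`): a covariant functional non-zero on `S` forces a non-zero
`w`-eigenvector of `ρ` inside `S`. [folklore] -/
theorem exists_eigenvector_of_covariant_functional_closed
    (ρ : Tg →* (H →L[ℂ] H)) (hρ : IsUnitaryRep ρ)
    (w : Tg →* ℂ) (hw : ∀ t, ‖w t‖ = 1)
    (S : Submodule ℂ H) [S.HasOrthogonalProjection] (hS : ∀ (t : Tg), ∀ v ∈ S, ρ t v ∈ S)
    (l : H →L[ℂ] ℂ) (hl : ∀ (t : Tg) (v : H), l (ρ t v) = w t * l v)
    {v₀ : H} (hv₀ : v₀ ∈ S) (h₀ : l v₀ ≠ 0) :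
    ∃ y ∈ S, y ≠ 0 ∧ ∀ t, ρ t y = w t • y :=
  exists_eigenvector_of_covariant_functional ρ hρ w hw S hS S.starProjection
    (fun v => S.starProjection_apply_mem v) (fun _ hv => Submodule.starProjection_eq_self_iff.mpr hv)
    (fun u v => Submodule.inner_starProjection_left_eq_right S u v) l hl hv₀ h₀

end Covariant

/-! ## A curve of functionals vanishing identically on a vector -/

section Calculus

/-- **Uniqueness of derivatives, read on one vector.** If a curve `L` of bounded functionals on a complex normed
space is differentiable at `s₀` with derivative `L'` (in operator norm) and `L s v = 0` for ALL `s`, then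
`L' v = 0`: evaluation at `v` is a bounded linear map, so `s ↦ L s v` has derivative `L' v`, and it is the zero
function. [folklore] -/
theorem hasDerivAt_apply_eq_zero {E : Type*} [NormedAddCommGroup E] [NormedSpace ℂ E]
    {L : ℝ → E →L[ℂ] ℂ} {L' : E →L[ℂ] ℂ} {s₀ : ℝ} (hL : HasDerivAt L L' s₀) (v : E)
    (h : ∀ s, L s v = 0) : L' v = 0 := by
  have h₁ : HasDerivAt (fun s => L s v) (L' v) s₀ := by
    have hc := (((ContinuousLinearMap.apply ℂ ℂ v).restrictScalars ℝ).hasFDerivAt).comp_hasDerivAt s₀ hL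
    simpa only [Function.comp_def, ContinuousLinearMap.coe_restrictScalars',
      ContinuousLinearMap.apply_apply] using hc
  have h₂ : HasDerivAt (fun s => L s v) 0 s₀ := by
    have hc : (fun s => L s v) = fun _ => (0 : ℂ) := funext h
    rw [hc]
    exact hasDerivAt_const s₀ (0 : ℂ)
  exact h₁.unique h₂

end Calculus

/-! ## Annihilator submodules under generating operators (pure algebra) -/

section Annihilator

variable {F : Type*} [AddCommGroup F] [Module ℂ F] {V : Type*} {ιX : Type*}

/-- The annihilator of a set `S` of vectors under a pairing `B`, linear in the first variable:
`{φ | B φ v = 0 for all v ∈ S}` — a `ℂ`-submodule of `F`. [folklore] -/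
def annihilatorIn (B : F →ₗ[ℂ] (V → ℂ)) (S : Set V) : Submodule ℂ F where
  carrier := {φ | ∀ v ∈ S, B φ v = 0}
  add_mem' {a b} ha hb v hv := by
    simp only [Set.mem_setOf_eq] at ha hb
    rw [map_add, Pi.add_apply, ha v hv, hb v hv, add_zero]
  zero_mem' v _ := by
    rw [map_zero, Pi.zero_apply]
  smul_mem' c {a} ha v hv := by
    simp only [Set.mem_setOf_eq] at ha
    rw [map_smul, Pi.smul_apply, ha v hv, smul_zero]

/-- Membership in `annihilatorIn B S` unfolds to `∀ v ∈ S, B φ v = 0`. [folklore] -/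
@[simp] theorem mem_annihilatorIn (B : F →ₗ[ℂ] (V → ℂ)) (S : Set V) (φ : F) :
    φ ∈ annihilatorIn B S ↔ ∀ v ∈ S, B φ v = 0 := Iff.rfl

/-- **Annihilators under generating operators.** A pairing `B`, linear in `φ`, whose annihilator of `S` is
stable under every operator `X k`, and which kills `S` at a vector `φ₀` GENERATING `F` under the `X k` (every
`X`-stable submodule containing `φ₀` is `⊤`), kills `S` everywhere. [folklore] -/
theorem vanishes_of_generator_of_stable (X : ιX → F →ₗ[ℂ] F) (S : Set V)
    (B : F →ₗ[ℂ] (V → ℂ))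
    (hstab : ∀ (k : ιX) (φ : F), (∀ v ∈ S, B φ v = 0) → ∀ v ∈ S, B (X k φ) v = 0)
    (φ₀ : F) (hgen : ∀ N : Submodule ℂ F, φ₀ ∈ N → (∀ k, ∀ φ ∈ N, X k φ ∈ N) → N = ⊤)
    (h₀ : ∀ v ∈ S, B φ₀ v = 0) : ∀ (φ : F), ∀ v ∈ S, B φ v = 0 := by
  have hN : annihilatorIn B S = ⊤ := hgen _ h₀ fun k φ hφ => hstab k φ hφ
  intro φ
  have hφ : φ ∈ annihilatorIn B S := by
    rw [hN]
    exact Submodule.mem_top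
  exact hφ

/-- **Infinitesimally invariant pairings vanishing on a cyclic vector.** A pairing `B`, linear in `φ`, with
`B (X k φ) v = - B φ (Y k v)` for `v` in a `Y`-stable set `Sm` of "smooth vectors", vanishing on a vector `φ₀`
against all of `Sm`, vanishes against `Sm` on the whole submodule generated by `φ₀` under the `X k` — here all
of `F`, by the generation hypothesis. (The case of `vanishes_of_generator_of_stable` in which stability of the
annihilator comes from infinitesimal invariance.) [folklore] -/
theorem pairing_vanishes_of_generator
    (X : ιX → F →ₗ[ℂ] F) (Y : ιX → V → V) (Sm : Set V)
    (hY : ∀ k, ∀ v ∈ Sm, Y k v ∈ Sm)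
    (B : F →ₗ[ℂ] (V → ℂ))
    (hinv : ∀ (k : ιX) (φ : F), ∀ v ∈ Sm, B (X k φ) v = - B φ (Y k v))
    (φ₀ : F) (hgen : ∀ N : Submodule ℂ F, φ₀ ∈ N → (∀ k, ∀ φ ∈ N, X k φ ∈ N) → N = ⊤)
    (h₀ : ∀ v ∈ Sm, B φ₀ v = 0) : ∀ (φ : F), ∀ v ∈ Sm, B φ v = 0 :=
  vanishes_of_generator_of_stable X Sm B
    (fun k φ hφ v hv => by rw [hinv k φ v hv, hφ (Y k v) (hY k v hv), neg_zero]) φ₀ hgen h₀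

end Annihilator

end Literature.RepresentationTheory.Unitary
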